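import Summits.AtomisticToContinuum.Crystallization.Theorems.FrustratedLawDichotomyStrainedPatchHomEntryLeafHTA2QCellBMA2
import Summits.AtomisticToContinuum.Crystallization.Theorems.FrustratedLawDichotomyStrainedPatchHomEntryLeafHTA2QExists

/-!
# ★★★ K1-v2 END TO END ON A BULK CELL COARSER THAN `2⁻¹⁰`: the MIXED cell `cB065 × wBMA` (`2⁻⁹` on five entry axes, `2⁻¹⁰` on the four heavy-tilt ones)
# `entryLeafOKHT4A2QQDCR muRec qX90c pBMA2 QBM GnBM JB065 tBM8 cB065 wBMA = true` (27623 `(H) HomFloor (1/625)`, hcp half; hand-1 g35; critic row 1331 (2c))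

decomp-a2c hand-1 g35.  KERNEL: `treeA2Q_BM` — the 8-leaf inner ζ-tree `tBM8` (`ζ_x × 2 · ζ_y × 2 · ζ_z × 2`; leaves `≈ (2.51, 2.92, 0.54)e-3` after the hull `(1.481, 1.617,
0.063)e-3`) closes the sheet-tracked confined box `(2.058, 2.609, 0.948)e-3` (seat probe T8: 94 s for the eight leaves); ★★★ `entryLeafOKHT4A2QQDCR_BMA2` (assembly with
`…CellBMA2.htCertSideA2Q_BMA2`), whence the hver conclusion on the whole mixed cell (`…HTA2QCentredRot.entryLeafOKHT4A2QQDCR_sound`) and ★ `okE_BM`: the cell is a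
one-leaf ∃-tree of the production verdict `entryLeafOKHT4A2QQDCRE muRec` (`…HTA2QExists`).  PER-CELL KERNEL COST OF RECORD (seat probes N1–N3, T8): rest 79 s +
components ≈ 3×90 s + lin/far 117 s + inner 94 s ≈ 560 s — below the `2⁻¹⁰` cell's ≈ 600–680 s while `2⁻⁹` on five of nine entry axes (hand-1 g35 FINDING §4).
For comparison the full `2⁻⁹` cell (`…CellB9A1/2`: certificate side ✓) needs ≥ 256 inner leaves of ≈ 20 s (hull `(2.29, 2.48)e-3` at the leaf budget).

Kernel fact + assembly; 0 sorry; standard axioms; no definitions.  `--supports stmt-AtomisticToContinuum-27623`.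
-/

namespace Summit.AtomisticToContinuum.Crystallization.Theorems.FrustratedLawDichotomyStrainedPatchHomEntryLeafHT

open Literature.Analysis.ValidatedNumerics.Numerics
open Summit.AtomisticToContinuum.Crystallization.Theorems.FrustratedLawDichotomyStrainedPatchHomCertTree (CertTree treeOK)
open Summit.AtomisticToContinuum.Crystallization.Theorems.FrustratedLawDichotomyStrainedPatchHomEntryTable (muRec)
open Summit.AtomisticToContinuum.Crystallization.Theorems.FrustratedLawDichotomyStrainedPatchHomEntryFitHcpCentred (entryLeafOKHQDCR)
open Summit.AtomisticToContinuum.Crystallization.Theorems.FrustratedLawDichotomyStrainedPatchHomSlopeLJ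
open Summit.AtomisticToContinuum.Crystallization.Theorems.FrustratedLawDichotomyStrainedPatchHomSlopeLJAffine
open Summit.AtomisticToContinuum.Crystallization.Theorems.FrustratedLawDichotomyStrainedPatchHomSlopeLJAffine2Kit

set_option maxRecDepth 100000 in
set_option maxHeartbeats 4000000 in
/-- ★ KERNEL: the 8-leaf inner ζ-tree closes the second-order confined box of the mixed cell (`≈ 94 s`). -/
theorem treeA2Q_BM : treeOK (hullInner (entryLeafOKHQDCR muRec qX90c) JB065 cB065) tBM8 cB065 (htWr pBMA2 cB065 wBMA) = true := by
  decide +kernel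

/-- ★★★ **THE MIXED BULK CELL CLOSES END TO END THROUGH THE SECOND-ORDER AFFINE LEAF** (`2⁻⁹` on five entry axes; certificate as is, `t = 0.01464`). [assembly] -/
theorem entryLeafOKHT4A2QQDCR_BMA2 : entryLeafOKHT4A2QQDCR muRec qX90c pBMA2 QBM GnBM JB065 tBM8 cB065 wBMA = true := by
  have h1 := htCertSideA2Q_BMA2
  have h2 := treeA2Q_BM
  unfold entryLeafOKHT4A2QQDCR entryLeafOKHT4A2Q
  rw [h1, h2]
  rfl

/-- ★ … hence the mixed cell is a one-leaf ∃-tree of the production verdict `entryLeafOKHT4A2QQDCRE muRec`. [formal bookkeeping] -/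
theorem okE_BM : ∃ t : CertTree ((Fin 3 × Fin 3) ⊕ Fin 3), treeOK (entryLeafOKHT4A2QQDCRE muRec) t cB065 wBMA = true :=
  exists_tree_HT4A2QQDCRE_of_cert entryLeafOKHT4A2QQDCR_BMA2

end Summit.AtomisticToContinuum.Crystallization.Theorems.FrustratedLawDichotomyStrainedPatchHomEntryLeafHT
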